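import Literature.Computation.Certificates.CovarianceBoxCertificate
import Literature.Computation.Certificates.TensorBernsteinEnclosure
import HarnessLib

/-!
# The tensor-weight box floor: per-vertex duals at the `2^κ` corners of a box, combined with the
# TENSOR-PRODUCT corner weights, and a floor read off leaf Bernstein representations
# (Bertsekas, *Nonlinear Programming*, Prop. 5.1.3 + Garloff 1986, §2)

Topic `Literature/Computation/Certificates`; composes `CovarianceBoxCertificate.lean` (pairwise-covariance weak duality for
per-vertex duals, `CovarianceBox.sum_mul_sub_cov_le`) with `TensorBernsteinEnclosure.lean` (range enclosure by tensor
Bernstein coefficients, `TensorBernstein.le_of_leafRepresentation`). It is the kernel form of floor **F2** of the exact reader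
`boxdual.reader` (cell hubbard-algo, seat hubbard-box-eng-3, `BOXDUAL-FORMAT.md` §1/§7): everything is PROVED; no definition,
no named fact, no number.

Setting. A box `Set.Icc lo hi ⊆ (κ → ℝ)` (`κ` finite), its corners indexed by selectors `s : κ → Fin 2`
(corner `j ↦ if s j = 1 then hi j else lo j`), an INDEPENDENT dual certificate at each corner (penalties `π s r y` affine in
the parameter and nonnegative on feasible points throughout the box, vertex bounds `β s` on the a-priori domain `D`, pairwise
prices `L s u` of the cross-defects on `D` — as in `CovarianceBoxCertificate`). A point `θ` of the box is the tensor-product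
convex combination of the corners with weights `w_s(x) = Π_k B_{1,s_k}(x_k)` (`B_{1,0}(t) = 1 - t`, `B_{1,1}(t) = t`,
Mathlib's `bernstein 1`), `x_k = (θ_k - lo_k)/(hi_k - lo_k)`; by `sum_mul_sub_cov_le` every feasible `y ∈ D` at `θ` has
`Q(x) := Σ_s w_s(x) β_s - ½ Σ_s Σ_u w_s(x) w_u(x) L_{su} ≤ c_y(θ)`. The reader bounds the polynomial `Q` below on `[0,1]^κ`
by branch and bound: leaves covering the cube, on each leaf a tensor Bernstein representation of `Q` (exact identities it
checks), floor `m` = least coefficient; `TensorBernstein.le_of_leafRepresentation` gives `m ≤ Q(x)`, hence `m ≤ c_y(θ)` for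
EVERY `θ` of the box. This is sharper than the any-convex-weights floor F1 (`le_of_forall_boxVertices_pairwiseBernstein`),
which must also cover weight vectors the tensor parametrisation never produces (e.g. half/half on a diagonal pair).

* `bernstein_one_zero_apply`, `bernstein_one_one_apply` — `B_{1,0}(t) = 1 - t`, `B_{1,1}(t) = t`;
* `sum_tensorWeight_mul_apply` — `Σ_s w_s(x) g(s_j) = (1 - x_j) g 0 + x_j g 1` (a function of one selector coordinate
  averages along that axis only); `sum_tensorWeight_eq_one`, `tensorWeight_nonneg`;
* `sum_tensorWeight_mul_corner` — `Σ_s w_s(x) corner(s)_j = lo_j + x_j (hi_j - lo_j)` (tensor weights reproduce the point);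
* `le_of_boxCorners_tensorLeaves` — THE BOX FLOOR: corner certificates + leaf representations of `Q` with coefficients `≥ m`
  ⇒ `m ≤ c_y(θ)` for all `θ ∈ Set.Icc lo hi`, `y ∈ F θ ∩ D`.

## Mathlib / tree search

`bernstein_apply`, `bernstein_nonneg`, `bernstein.probability`; `Fintype.prod_sum`, `Finset.prod_mul_distrib`,
`Finset.prod_ite_eq'`, `Finset.prod_eq_single`, `Fin.sum_univ_two`; tree: `CovarianceBox.sum_mul_sub_cov_le` (p456901),
`TensorBernstein.le_of_leafRepresentation` (p457994).

## References

* D. P. Bertsekas, *Nonlinear Programming*, 2nd ed., Athena Scientific 1999, Prop. 5.1.3 (weak duality, pointwise).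
  [cite: Bertsekas1999NonlinearProgramming, Prop. 5.1.3]
* J. Garloff, *Convergent bounds for the range of multivariate polynomials*, LNCS 212 (1986) 37–56, §2.
  [cite: Garloff1986, §2]
-/

namespace Literature.Computation.Certificates.CovarianceBox

open Finset
open scoped unitInterval

variable {κ : Type*} [Fintype κ]

/-- `B_{1,0}(t) = 1 - t`. [cite: Garloff1986, §2] -/
theorem bernstein_one_zero_apply (t : I) : bernstein 1 0 t = 1 - (t : ℝ) := by
  simp [bernstein_apply]

/-- `B_{1,1}(t) = t`. [cite: Garloff1986, §2] -/
theorem bernstein_one_one_apply (t : I) : bernstein 1 1 t = (t : ℝ) := by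
  simp [bernstein_apply]

/-- Degree-one tensor weights are nonnegative. [cite: Garloff1986, §2] -/
theorem tensorWeight_nonneg (x : κ → I) (s : κ → Fin 2) : 0 ≤ ∏ k, bernstein 1 (s k) (x k) :=
  Finset.prod_nonneg fun _ _ => bernstein_nonneg

variable [DecidableEq κ]

/-- **Averaging a function of one selector coordinate**: for `j : κ` and `g : Fin 2 → ℝ`,
`Σ_s (Π_k B_{1,s_k}(x_k)) g(s_j) = (1 - x_j) g 0 + x_j g 1` (the other axes integrate out by `Σ_ν B_{1,ν} = 1`).
[cite: Garloff1986, §2] -/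
theorem sum_tensorWeight_mul_apply (x : κ → I) (j : κ) (g : Fin 2 → ℝ) :
    ∑ s : κ → Fin 2, (∏ k, bernstein 1 (s k) (x k)) * g (s j) = (1 - (x j : ℝ)) * g 0 + (x j : ℝ) * g 1 := by
  have key := Fintype.prod_sum (fun k (i : Fin 2) => bernstein 1 i (x k) * (if k = j then g i else 1))
  have rhs : ∀ s : κ → Fin 2, ∏ k, bernstein 1 (s k) (x k) * (if k = j then g (s k) else 1) =
      (∏ k, bernstein 1 (s k) (x k)) * g (s j) := by
    intro s
    rw [Finset.prod_mul_distrib, Finset.prod_ite_eq' Finset.univ j (fun k => g (s k))]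
    simp
  have lhs : ∏ k, ∑ i : Fin 2, bernstein 1 i (x k) * (if k = j then g i else 1) =
      ∑ i : Fin 2, bernstein 1 i (x j) * g i := by
    rw [Finset.prod_eq_single j]
    · simp
    · intro k _ hk
      simp only [hk, if_false, mul_one]
      exact bernstein.probability 1 (x k)
    · intro h; exact absurd (Finset.mem_univ j) h
  rw [Finset.sum_congr rfl fun s _ => (rhs s).symm, ← key, lhs, Fin.sum_univ_two]
  simp only [Fin.val_zero, Fin.val_one, bernstein_one_zero_apply, bernstein_one_one_apply]

/-- Degree-one tensor weights sum to one. [cite: Garloff1986, §2] -/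
theorem sum_tensorWeight_eq_one [Nonempty κ] (x : κ → I) : ∑ s : κ → Fin 2, ∏ k, bernstein 1 (s k) (x k) = 1 := by
  obtain ⟨j⟩ := ‹Nonempty κ›
  have := sum_tensorWeight_mul_apply x j (fun _ => 1)
  simp only [mul_one] at this
  rw [this]; ring

/-- **Tensor weights reproduce the point**: `Σ_s w_s(x) corner(s)_j = lo_j + x_j (hi_j - lo_j)` for every coordinate
`j`. [cite: Garloff1986, §2] -/
theorem sum_tensorWeight_mul_corner (lo hi : κ → ℝ) (x : κ → I) (j : κ) :
    ∑ s : κ → Fin 2, (∏ k, bernstein 1 (s k) (x k)) * (if s j = 1 then hi j else lo j) =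
      lo j + (x j : ℝ) * (hi j - lo j) := by
  have := sum_tensorWeight_mul_apply x j (fun i => if i = 1 then hi j else lo j)
  rw [this, if_neg (by decide), if_pos rfl]
  ring

/-- **The tensor-weight box floor (reader floor F2).** Box `Set.Icc lo hi ⊆ (κ → ℝ)`; at each corner
`s : κ → Fin 2` (corner `j ↦ if s j = 1 then hi j else lo j`) an independent dual certificate: penalties `π s r y` affine
in the parameter and nonnegative on feasible points throughout the box, vertex bound `β s` on the a-priori domain `D`,
pairwise prices `L s u` on `D` (hypotheses as in `le_of_forall_boxVertices_pairwiseBernstein`). If the weight polynomial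
`Q(x) = Σ_s w_s(x) β_s - ½ Σ_s Σ_u w_s(x) w_u(x) L_{su}` (`w_s(x) = Π_k B_{1,s_k}(x_k)`) is represented on leaves covering
`[0,1]^κ` by tensor Bernstein forms all of whose coefficients are `≥ m`, then `m ≤ c_y(θ)` for every `θ` of the box and
every `y ∈ F θ ∩ D`. [cite: Bertsekas1999NonlinearProgramming, Prop. 5.1.3] -/
theorem le_of_boxCorners_tensorLeaves [Nonempty κ] {Y R Λ : Type*} {ν : κ → ℕ}
    (lo hi : κ → ℝ) (F : (κ → ℝ) → Set Y) (D : Set Y) (c : Y → (κ → ℝ) →ᵃ[ℝ] ℝ)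
    (Rs : Finset R) (π : (κ → Fin 2) → R → Y → (κ → ℝ) →ᵃ[ℝ] ℝ)
    (hπpos : ∀ s, ∀ r ∈ Rs, ∀ θ ∈ Set.Icc lo hi, ∀ y ∈ F θ, 0 ≤ π s r y θ)
    (β : (κ → Fin 2) → ℝ)
    (hβ : ∀ s, ∀ y ∈ D, β s ≤ c y (fun j => if s j = 1 then hi j else lo j) -
      ∑ r ∈ Rs, π s r y (fun j => if s j = 1 then hi j else lo j))
    (L : (κ → Fin 2) → (κ → Fin 2) → ℝ)
    (hL : ∀ s u, ∀ y ∈ D, -L s u ≤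
      (∑ r ∈ Rs, (π s r y (fun j => if s j = 1 then hi j else lo j) - π u r y (fun j => if s j = 1 then hi j else lo j))) -
        ∑ r ∈ Rs, (π s r y (fun j => if u j = 1 then hi j else lo j) - π u r y (fun j => if u j = 1 then hi j else lo j)))
    (leaf : Λ → Set (κ → I)) (hcover : ∀ x, ∃ ℓ, x ∈ leaf ℓ) (φ : Λ → (κ → I) → (κ → I))
    (b : Λ → ((j : κ) → Fin (ν j + 1)) → ℝ)
    (hrep : ∀ ℓ, ∀ x ∈ leaf ℓ,
      (∑ s : κ → Fin 2, (∏ k, bernstein 1 (s k) (x k)) * β s -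
        (1 / 2) * ∑ s : κ → Fin 2, ∑ u : κ → Fin 2,
          (∏ k, bernstein 1 (s k) (x k)) * (∏ k, bernstein 1 (u k) (x k)) * L s u) =
      ∑ J : (j : κ) → Fin (ν j + 1), b ℓ J * ∏ j, bernstein (ν j) (J j) (φ ℓ x j))
    (m : ℝ) (hm : ∀ ℓ J, m ≤ b ℓ J)
    {θ : κ → ℝ} (hθ : θ ∈ Set.Icc lo hi) {y : Y} (hyF : y ∈ F θ) (hyD : y ∈ D) : m ≤ c y θ := by
  classical
  -- the cube point of θ
  have hx01 : ∀ j, lo j < hi j → 0 ≤ (θ j - lo j) / (hi j - lo j) ∧ (θ j - lo j) / (hi j - lo j) ≤ 1 := by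
    intro j h
    have h1 : 0 < hi j - lo j := sub_pos.2 h
    exact ⟨div_nonneg (sub_nonneg.2 (hθ.1 j)) h1.le, (div_le_one h1).2 (sub_le_sub_right (hθ.2 j) _)⟩
  let x : κ → I := fun j =>
    if h : lo j < hi j then ⟨(θ j - lo j) / (hi j - lo j), ⟨(hx01 j h).1, (hx01 j h).2⟩⟩ else 0
  have hxθ : ∀ j, lo j + (x j : ℝ) * (hi j - lo j) = θ j := by
    intro j
    by_cases h : lo j < hi j
    · have h1 : hi j - lo j ≠ 0 := (sub_pos.2 h).ne'
      simp only [x, dif_pos h]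
      field_simp
      ring
    · have hle : hi j ≤ lo j := not_lt.1 h
      have e1 : lo j = hi j := le_antisymm (le_trans (hθ.1 j) (hθ.2 j)) hle
      have e2 : θ j = lo j := le_antisymm (e1 ▸ hθ.2 j) (hθ.1 j)
      simp only [x, dif_neg h]
      rw [e2, e1]; simp
  -- corner map and weights
  set v : (κ → Fin 2) → κ → ℝ := fun s j => if s j = 1 then hi j else lo j with hv
  set w : (κ → Fin 2) → ℝ := fun s => ∏ k, bernstein 1 (s k) (x k) with hw
  have hw0 : ∀ s ∈ (Finset.univ : Finset (κ → Fin 2)), 0 ≤ w s := fun s _ => tensorWeight_nonneg x s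
  have hw1 : ∑ s ∈ (Finset.univ : Finset (κ → Fin 2)), w s = 1 := sum_tensorWeight_eq_one x
  have hcomb : ∑ s ∈ (Finset.univ : Finset (κ → Fin 2)), w s • v s = θ := by
    funext j
    rw [Finset.sum_apply]
    simp only [Pi.smul_apply, smul_eq_mul, hw, hv]
    rw [sum_tensorWeight_mul_corner lo hi x j, hxθ j]
  -- weak duality with the combined dual at θ
  have key := sum_mul_sub_cov_le (E := κ → ℝ) Finset.univ w hw0 hw1 v F D c Rs π
    (fun s _ r hr y' hy' => by rw [hcomb] at hy' ⊢; exact hπpos s r hr θ hθ y' hy')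
    β (fun s _ y' hy' => hβ s y' hy') L (fun s _ u _ y' hy' => hL s u y' hy')
    (y := y) (by rwa [hcomb]) hyD
  rw [hcomb] at key
  -- the Bernstein floor of the weight polynomial at x
  have hQ := TensorBernstein.le_of_leafRepresentation (κ := κ) (Set.univ : Set (κ → I))
    (fun x' => ∑ s : κ → Fin 2, (∏ k, bernstein 1 (s k) (x' k)) * β s -
        (1 / 2) * ∑ s : κ → Fin 2, ∑ u : κ → Fin 2,
          (∏ k, bernstein 1 (s k) (x' k)) * (∏ k, bernstein 1 (u k) (x' k)) * L s u)
    leaf (fun x' _ => hcover x') φ b (fun ℓ x' hx' _ => hrep ℓ x' hx') m hm (Set.mem_univ x)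
  have e : (∑ s : κ → Fin 2, (∏ k, bernstein 1 (s k) (x k)) * β s -
        (1 / 2) * ∑ s : κ → Fin 2, ∑ u : κ → Fin 2,
          (∏ k, bernstein 1 (s k) (x k)) * (∏ k, bernstein 1 (u k) (x k)) * L s u) =
      ∑ s ∈ Finset.univ, w s * β s - (1 / 2) * ∑ s ∈ Finset.univ, ∑ u ∈ Finset.univ, w s * w u * L s u := by
    simp only [hw]
  linarith [hQ, key, e]

end Literature.Computation.Certificates.CovarianceBox
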